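import Summits.Ventures.PercRepro.PlaneWeighting

/-!
# PercRepro — Theorem O Step 1, part B: the tie lines, the weight `wt` of a witness and `supply_ge` (p2, gen 5; split gen 6)

Continuation of `PlaneWeighting.lean` (split for the 400-line file limit; proofs unchanged).
-/

namespace PercRepro

namespace ThmO

open Finset ThmH

variable {α : Type*} [DecidableEq α] {M : Matroid α} [M.Finite]

/-! ### Counting the tie lines, the weight of a witness, the supply of a plane -/

section Supply

variable {G B : Finset α}

omit [DecidableEq α] [M.Finite] in
/-- A rank-3 set has at least three points. -/
theorem three_le_card_of_eRk_three (hr : M.eRk (B : Set α) = 3) : 3 ≤ B.card := by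
  have := M.eRk_le_encard (B : Set α)
  rw [hr, Set.encard_coe_eq_coe_finsetCard] at this
  exact_mod_cast this

/-- With `|B′| ≥ 4` there is at most one tie line (two would share two points of `B′`). -/
theorem card_tieLines_le_one (hs : Simple M) (G : Finset α) (hB4 : 4 ≤ B.card) :
    (tieLines M G B).card ≤ 1 := by
  classical
  rw [Finset.card_le_one]
  intro ℓ hℓ ℓ' hℓ'
  simp only [tieLines, Finset.mem_filter] at hℓ hℓ'
  obtain ⟨hℓl, -, hℓc⟩ := hℓ
  obtain ⟨hℓl', -, hℓc'⟩ := hℓ'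
  -- |ℓ ∩ ℓ′ ∩ B| ≥ |B| − 2 ≥ 2
  have hunion : (ℓ ∩ B) ∪ (ℓ' ∩ B) ⊆ B := Finset.union_subset Finset.inter_subset_right Finset.inter_subset_right
  have h1 := Finset.card_le_card hunion
  have h2 := Finset.card_union_add_card_inter (ℓ ∩ B) (ℓ' ∩ B)
  have hint : 2 ≤ ((ℓ ∩ B) ∩ (ℓ' ∩ B)).card := by omega
  obtain ⟨a, ha, b, hb, hab⟩ := Finset.one_lt_card.1 (show 1 < ((ℓ ∩ B) ∩ (ℓ' ∩ B)).card by omega)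
  simp only [Finset.mem_inter] at ha hb
  exact lines_eq_of_two_mem hs hℓl hℓl' ha.1.1 hb.1.1 ha.2.1 hb.2.1 hab

/-- With `|B′| = 3` there are at most three tie lines (one per pair of `B′`). -/
theorem card_tieLines_le_three (hs : Simple M) (G : Finset α) (hB3 : B.card = 3) :
    (tieLines M G B).card ≤ 3 := by
  classical
  have h := Finset.card_le_card_of_injOn (fun ℓ => ℓ ∩ B) (s := tieLines M G B) (t := B.powersetCard 2) ?_ ?_
  · rwa [Finset.card_powersetCard, hB3] at h
  · intro ℓ hℓ
    simp only [Finset.mem_coe, tieLines, Finset.mem_filter] at hℓ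
    rw [Finset.mem_coe, Finset.mem_powersetCard]
    refine ⟨Finset.inter_subset_right, ?_⟩
    show (ℓ ∩ B).card = 2
    omega
  · intro ℓ hℓ ℓ' hℓ' heq
    simp only [Finset.mem_coe, tieLines, Finset.mem_filter] at hℓ hℓ'
    simp only at heq
    obtain ⟨a, ha, b, hb, hab⟩ := Finset.one_lt_card.1 (show 1 < (ℓ ∩ B).card by omega)
    have ha' : a ∈ ℓ' ∩ B := heq ▸ ha
    have hb' : b ∈ ℓ' ∩ B := heq ▸ hb
    exact lines_eq_of_two_mem hs hℓ.1 hℓ'.1 (Finset.mem_inter.1 ha).1 (Finset.mem_inter.1 hb).1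
      (Finset.mem_inter.1 ha').1 (Finset.mem_inter.1 hb').1 hab

open scoped Classical in
/-- The guaranteed weight of a rank-3 subset `B′` of a plane: `1/4` for a triple, `1/2` when a tie line exists,
`1` otherwise. -/
noncomputable def wt (M : Matroid α) [M.Finite] (G B : Finset α) : ℚ :=
  if B.card = 3 then 1 / 4 else if (tieLines M G B).Nonempty then 1 / 2 else 1

/-- `wt ≥ 0`. -/
theorem wt_nonneg (M : Matroid α) [M.Finite] (G B : Finset α) : 0 ≤ wt M G B := by
  unfold wt; split_ifs <;> norm_num

/-- `wt ≥ 1/4`. -/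
theorem wt_ge (M : Matroid α) [M.Finite] (G B : Finset α) : 1 / 4 ≤ wt M G B := by
  unfold wt; split_ifs <;> norm_num

/-- **The weight a witness pays its plane is at least `wt(B′)`.** -/
theorem w_witness_ge (hs : Simple M) (hG : G ∈ planes M) (hB : B ⊆ G) (hr : M.eRk (B : Set α) = 3)
    {x : α} (hx : x ∈ gr M) (hxG : x ∉ G) : wt M G B ≤ w M G (insert x B) := by
  classical
  have hmem := mem_Max_witness hG hB hr hxG
  have hcard := card_Max_le hs hG hB hr hx hxG
  have hpos : 0 < (Max M (insert x B)).card := Finset.card_pos.2 ⟨G, hmem⟩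
  unfold w
  rw [if_pos hmem]
  have key : ∀ n : ℕ, (Max M (insert x B)).card ≤ n → 0 < n →
      (1 / (n : ℚ)) ≤ 1 / ((Max M (insert x B)).card : ℚ) := by
    intro n hn hn0
    apply one_div_le_one_div_of_le (by exact_mod_cast hpos) (by exact_mod_cast hn)
  have h3 := three_le_card_of_eRk_three hr
  unfold wt
  split_ifs with h1 h2
  · -- |B′| = 3: at most four maximizers
    have := card_tieLines_le_three hs G h1
    exact key 4 (by omega) (by norm_num)
  · -- a tie line exists, |B′| ≥ 4: at most two maximizers
    have := card_tieLines_le_one hs G (B := B) (by omega)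
    exact key 2 (by omega) (by norm_num)
  · -- no tie line: `G` is the only maximizer
    have h0 : (tieLines M G B).card = 0 := by
      rw [Finset.card_eq_zero, Finset.not_nonempty_iff_eq_empty.1 h2]
    have h1' : (Max M (insert x B)).card = 1 := by omega
    rw [h1']; norm_num

open scoped Classical in
/-- The witnesses of a plane: pairs `(B′, x)` with `B′ ∈ N₃(G)` and `x ∈ E ∖ G`. -/
noncomputable def Wit (M : Matroid α) [M.Finite] (G : Finset α) : Finset (Σ _ : Finset α, α) :=
  (N3 M G).sigma (fun _ => gr M \ G)

/-- The set of a witness. -/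
def fW (q : Σ _ : Finset α, α) : Finset α := insert q.2 q.1

/-- A witness is a rank-4 set. -/
theorem fW_mem_Y (hG : G ∈ planes M) {q : Σ _ : Finset α, α} (hq : q ∈ Wit M G) : fW q ∈ Y M := by
  obtain ⟨B, x⟩ := q
  simp only [Wit, Finset.mem_sigma, N3, Finset.mem_filter, Finset.mem_powerset, Finset.mem_sdiff] at hq
  obtain ⟨⟨hB, hr⟩, hx, hxG⟩ := hq
  simp only [Y, fW, Finset.mem_filter, Finset.mem_powerset]
  exact ⟨Finset.insert_subset hx (hB.trans (mem_planes.1 hG).1), eRk_insert_eq_four hG hB hr hx hxG⟩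

/-- The witness map is injective (`B′ = S ∩ G`, `x` = the point of `S` off `G`). -/
theorem fW_injOn (G : Finset α) : Set.InjOn fW (Wit M G : Set (Σ _ : Finset α, α)) := by
  rintro ⟨B, x⟩ hq ⟨B', x'⟩ hq' h
  simp only [Finset.mem_coe, Wit, Finset.mem_sigma, N3, Finset.mem_filter, Finset.mem_powerset,
    Finset.mem_sdiff] at hq hq'
  obtain ⟨⟨hB, -⟩, -, hxG⟩ := hq
  obtain ⟨⟨hB', -⟩, -, hxG'⟩ := hq'
  simp only [fW] at h
  have hBB : B = B' := by
    rw [← witness_inter_self hB hxG, ← witness_inter_self hB' hxG', h]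
  subst hBB
  have hxx : x = x' := by
    have : x ∈ insert x' B := by rw [← h]; exact Finset.mem_insert_self _ _
    rw [Finset.mem_insert] at this
    rcases this with h' | h'
    · exact h'
    · exact absurd (hB h') hxG
  subst hxx
  rfl

/-- **The supply of a plane**: `supply(G) ≥ |E ∖ G| · Σ_{B′ ∈ N₃(G)} wt(B′)`. -/
theorem supply_ge (hs : Simple M) (hG : G ∈ planes M) :
    ∑ B ∈ N3 M G, ((gr M \ G).card : ℚ) * wt M G B ≤ supply M G := by
  classical
  have h1 : ∑ q ∈ Wit M G, w M G (fW q) ≤ supply M G := by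
    unfold supply
    rw [← Finset.sum_image (fW_injOn G)]
    apply Finset.sum_le_sum_of_subset_of_nonneg
    · intro S hS
      rw [Finset.mem_image] at hS
      obtain ⟨q, hq, rfl⟩ := hS
      exact fW_mem_Y hG hq
    · intro S _ _
      exact w_nonneg M G S
  refine le_trans ?_ h1
  rw [Wit, Finset.sum_sigma]
  apply Finset.sum_le_sum
  intro B hB
  simp only [N3, Finset.mem_filter, Finset.mem_powerset] at hB
  calc ((gr M \ G).card : ℚ) * wt M G B = ∑ x ∈ gr M \ G, wt M G B := by
        rw [Finset.sum_const, nsmul_eq_mul]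
    _ ≤ ∑ x ∈ gr M \ G, w M G (fW ⟨B, x⟩) := by
        apply Finset.sum_le_sum
        intro x hx
        rw [Finset.mem_sdiff] at hx
        exact w_witness_ge hs hG hB.1 hB.2 hx.1 hx.2

end Supply

end ThmO

end PercRepro
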